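import Summits.BirchSwinnertonDyer.Rank1Residual.X11b.KolyvaginSqueezeRecordsKitThree
import HarnessLib

/-!
# BSD rank-≤1 residual cell, rank ONE at `p = 3` with `#Ш_an = 9` (cells (3,'X11b') / (3,'X4') / (3,'X7') /
(3,'X8')): `BSD(E,3)` PER PAIR by the
# Kolyvagin SQUEEZE — Heegner-index certificate `ord₃ [E(K):ℤy_K] = 1` (upper half, two engines) × two-engine EXACT
`3`-descent `dim Sel³(E/ℚ) = 3`
# (lower half, Cassels–Tate) — records 10 of 11 (unit `b2b-bsdres-x11c` GEN 38 «KOLY3-SQUEEZE»,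
prover-b2b-bsdres-x11c-g38-0, 2026-08-28)

HONEST FRAMING (cell `b2b-bsdres-*`, verbatim): prove what is provable now; shrink each hard class to its core with
data; no claim beyond
stated classes; COMBINATION classes deleted from PUBLISHED theorems only, CONSTRUCTION-shaped remainder typed; this
is not "finishing BSD".
X11b (and X11 ∧ r = 1 ∧ p = 3, R6.2), X4, X7, X8 stay CONSTRUCTION-SHAPED as classes; PER PAIR; nothing booked by
this file (referee A
books); NO named fact introduced; NO definition; class labels of other cells' classes (X4: n1011 / additive-p*,
X7/X8: x10b /
additive-p3 / bsd-ssimc) are untouched — these are SERVICE records on their cells, nothing of theirs superseded.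

WHAT. On referee A2's state `pub-bsdpct-r5-g15/scratchA2_state_after_kurx4am_add1c5_onA2R1030_fold.pkl`
(45ab5fdd2800f5ab) there
are 77 rank-ONE residue classes with an open cell `(3, X)`, `X ∈ {X11b, X4, X7, X8}`, whose curve `…1` has
`#Ш_an = 9`, `ρ̄_{E,3}`
onto (no Cremona galrep 3-code) and `3 ∤ #E(ℚ)_tors·∏c_ℓ` (population
`HOME/b2b-bsdres-x11c/gen38/squeeze/pop/pop38b.json`). On such
a cell neither a Kolyvagin `3 ∤ [E(K):ℤy_K]` certificate (GEN 35 KOLY3) nor a `dim Sel³ = rank` certificate (T-SEL3)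
can exist: BSD
predicts `Ш(E)[3^∞] ≅ (ℤ/3)²`. THE SQUEEZE (unit `b2b-bsdres-sha-2`'s
`Rank1Residual.bsdp_of_kolyvagin_index_of_casselsTate_of_pow_dvd`,
`X4/KolyvaginSqueeze.lean`; ANY odd `p`, analytic rank `≤ 1`, NO hypothesis on the reduction of `E` at `p`): UPPER
half
`ord₃ #Ш(E/ℚ) ≤ 2` from Kolyvagin as printed by McCallum 1991 §1 (`ord₃ #Ш(E/K) ≤ 2·ord₃ [E(K):ℤy_K]`, named facts
`kolyvagin`,
`Kolyvagin1990_padicValNat_card_sha_le`, registry A20, referee C2 ROUND 326 «p = 3 allowed as printed») with the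
odd-part splitting
`#Ш(E/K)[3^∞] = #Ш(E/ℚ)[3^∞]·#Ш(E^{(d_K)}/ℚ)[3^∞]` (JSW 2017 §7.4.1, tree theorem) and the certificate
`ord₃ [E(K):ℤy_K] ≤ 1`;
LOWER half `9 ∣ #Ш(E/ℚ)` from ONE descent line `#Sel^(3)(E/ℚ) = 27` (`rank = r_an = 1` by GZK, `3 ∤ #E(ℚ)_tors` by the
irreducibility of `E[3]` ⇒ `Ш(E)[3] ≠ 0`, `Typed.exists_sha_torsion_of_pow_rank_lt_card_selmerGroup`) and
Cassels–Tate squareness;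
with `#Ш_an = 9`: Miller's `BSD(E,3)`. KERNEL (per pair, through the unit's GEN 38 kit
`X11b.bsdp_three_of_kolyvaginIndexLeOne_of_card_selmer_of_irr_of_order`,
`X11b/KolyvaginSqueezeRecordsKitThree.lean`, every numeric
hypothesis a `decide` / `norm_num` goal): global minimality of Cremona's model by prover B's factored Kraus
criterion on the COMPLETE
factorisation of `|Δ|`; `ρ̄_{E,3}` ONTO from two Frobenius witnesses (Serre 1972 Prop. 15: an irreducible Frobenius
and one of order 3,
schema point counts). DISPLAYED binders per record (evidence, certified outside Lean — exactly the KOLY3 tuple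
referee A booked flag-free
at R958 / R961, plus `hCT`, the twist datum and `hSel`): `hGZK`, `hCT`, `hKo`, `hB`; the Heegner datum `K = ℚ(√D)`
(`hK`, `hH`),
`P = y_K` (`hP`, `hnt`) with `hI : ord₃ [E(K):ℤP] ≤ 1`; the twist datum `Wd` = Cremona's / PARI's minimal model of
`E^{(D)}` with
`hWd` (a `ℚ`-isomorphism class statement) and `hrD : r_an(Wd) ≤ 1` (the engines: root number `+1`, `L(E^D,1) ≠ 0`);
`hr : r_an = 1`,
`hq`/`hv : #Ш_an = 9` (Cremona); `hSel : #Sel^(3)(E/ℚ) = 3^3`.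
ENGINES (all BYTE-IDENTICAL, sha256 in each run folder's `outputs/inputs.sha256`; run folders
`HOME/b2b-bsdres-x11c/gen38/squeeze/harvest/<job>/`
with the daemon's `MANIFEST.json`): Heegner index — ENGINE 1 = the unit's gen-3 `main.py` (sha256 `69e29ec7…` = X9
g7 `jobD1b.py`;
PARI `ellL1`, `ellheight`, period lattice; `m² = 4·ĥ(y_K)/ĥ(x)` with `x` Cremona's generator saturated; kit j303974,
NDISC 12 /
DBOUND 6000: per pair the FIRST Heegner field `K = ℚ(√D)` (every `q ∣ N` split, `3 ∤ D`) with `ord₃ m = 1` is the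
certificate
field; earlier fields with `ord₃ m ≥ 2` are listed per row) ‖ ENGINE 2 = `run_cert.py` (sha256 `1b54bb20…`, stdlib
only, X9 gen 7:
recomputes `a_ℓ`, `L'(E,1)`, `L(E^D,1)`, the period lattice, `ĥ(x)` by Tate's series, `ĥ(y_K)` by
Gross–Zagier–Zhang, `m`,
`ord₃ m` — EQUAL —, plus a `3`-saturation witness prime for `x` and an `E(K)[3] = 0` witness prime; kit j304100) ‖
STAGE C =
additive-p1's `twistvals` (sha256 `e501b988…`; kit j304101): `N_{E^D}`, root number, `L(E^D,1)`, `Ω`, `#tors`, `∏c`,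
`#Ш_an(E^D)`
(BSD-consistency of the twist side: `3 ∤ #tors(E^D)·#Ш_an(E^D)`, as the squeeze predicts `Ш(E^D)[3] = 0`). Descent —
ENGINE C =
unit `b2b-bsdres-x11b`'s `desc3lib.gp` (sha256 `c4fb20b7…`, exact-element Schaefer–Stoll, one orbit = surjective
image; kit j305968) ‖
ENGINE E = unit `b2b-bsdres-x10b`'s INDEPENDENT `desc3full_e2.py` (sha256 `dfa51aff…`; kit j305969): per row the
descent grade EE / EL / LE / LL
(E = `EXACT(bnfcertify1+3sat)` equality, L = three independent EXACTLY verified Selmer elements = the unconditional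
lower bound `dim ≥ 3`,
equality modulo the class group); every row `dim Sel^(3)(E/ℚ) ≥ 3` on BOTH engines (expected `= rank + 2`),
Cremona's generator located in
the Selmer group; the kit consumes only `3³ ≤ #Sel^(3)(E/ℚ)` (`…_of_le_card_selmer_…`, the kit file's second
theorem). Tables:
`HOME/b2b-bsdres-x11c/gen38/squeeze/harvest/rows38b.json`, `gen38/squeeze/ROWS38B-TABLE.md`. THIS FILE (records 10):
7 pairs — `314975c1` (X7), `389104b1` (X7), `389525a1` (X7), `403280p1` (X7), `404968b1` (X7), `453200bn1` (X7),
`480704bq1` (X7).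

References: McCallum 1991 §1 [McCallumLMS1991]; Gross 1991 [GrossLMS1991]; Kolyvagin 1990
[KolyvaginEulerSystems1990]; Gross–Zagier
1986 [GrossZagier1986]; Jetchev–Skinner–Wan 2017 §7.4 [JetchevSkinnerWan2017]; Serre 1972 §2.4 Prop. 15 [Serre1972];
Silverman AEC
X.4.2, X.4.14, VII.3.1 [SilvermanAEC2009]; Kraus 1989 [Kraus1989]; Schaefer–Stoll 2004 [SchaeferStoll2004]; Miller
2011 Def. 1.1, Thm.
4.1 [Miller2011LMS]; Cremona's tables [Cremona2006].
-/

set_option autoImplicit false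

noncomputable section

open scoped Classical

open WeierstrassCurve Literature.NumberTheory.EllipticCurves
  Literature.NumberTheory.EllipticCurves.Rank1Residual
  Literature.NumberTheory.EllipticCurves.Rank1Residual.Typed
  Literature.NumberTheory.EllipticCurves.Rank1Residual.X11RankOneCertificates
  Summit.BirchSwinnertonDyer.BirchSwinnertonDyer.Rank1Residual.IntModel
  Summit.BirchSwinnertonDyer.BirchSwinnertonDyer.Rank1Residual.X11RankOne

namespace Summit.BirchSwinnertonDyer.Rank1Residual.X11b

/-- **`BSD(E,3)` for `314975c1`** (`N = 314975 = 5²·43·293`; good supersingular at `3`, not semistable (class X7); `#tors = 1`, `∏c = 2`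
(`3 ∤ #tors·∏c`), `r_an = 1`, **`#Ш_an = 9`**, galrep none (no 3-code: `ρ̄_{E,3}` onto), generator `(-164, 21)`; residue class of A2 state
`45ab5fdd`, (3,'X7') the SOLE open cell). HEEGNER INDEX (upper half): fields with `ord₃ m ≥ 2` before the certificate field: none. `D = -71` (71
prime; every prime of `N` split, `3 ∤ D`): **`m = 24`, `ord₃ m = 1`** (`ρ = ĥ(y_K)/ĥ(x) = 143.99…`; `L′(E,1) = 8.45216259…`,
`L(E^D,1) = 0.69430136…`, `ĥ(x) = 1.65411555…`) — engine 1 (j303974) = engine 2 (j304100; EQUAL `m = 24`, `ord₃ m = 1`, dev. ≤ 1.8e-15, checks true;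
`3`-saturation witness prime [7, 6], `E(K)[3] = 0` witness prime [13, 'inert', 160]); twist `E^D` (stage C j304101): minimal model
`[0, 0, 1, -403280000, 3116901497656]`, `N_{E^D} = 1587788975`, root number `+1`, `L(E^D,1) = 0.69430136… ≠ 0` ⇒ `r_an(E^D) = 0`; `#tors = 1`,
`∏c = 8`, `#Ш_an(E^D) = 1` — `3 ∤ #tors·#Ш_an(E^D)` (BSD-shape: the squeeze forces `Ш(E^D)[3] = 0`). DESCENT (lower half): engine C x11b `desc3lib`
(j305968): octic `A` disc `-861019748829539021671875`, `S = [3, 5, 7, 11, 43, 293]`, `Cl(A) = [72, [12, 6]]`, `bnfcertify(A,1) = 1`, `23` generators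
3-saturated, `dim H¹(ℚ,E[3];S) = 5`, **`dim Sel^(3)(E/ℚ) = 3`** (expected 3: MATCH), generator in `Sel`, mode `GRH(3sat)`, cert
`certs/cert_314975c1.gp` `2b256f8a5f506406…`; engine E x10b `desc3full_e2` (j305969): `Cl = [72, [12, 6]]`, `Cl_S = [1, []]`, `23` generators,
`bnfcertify = -2`, `dim H¹ = 5`, **`dim Sel^(3)(E/ℚ) = 3`**, mode `LOWERBOUND` — TWO independent implementations, descent grade **LL** (E = equality
EXACT, L = three independent EXACTLY verified Selmer elements = the unconditional LOWER bound `dim ≥ 3`; the kit uses only `3³ ≤ #Sel`) ⇒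
`27 ≤ #Sel^(3)(E/ℚ)`, `Ш(E)[3] ≠ 0` — the lower half. Witnesses mod `3` `(ℓ,#Ẽ(𝔽_ℓ))` = `(13,8)` (`a = 6`: `X² − aX + ℓ` root-free over `𝔽₃`),
`(7,6)` (`ℓ ≡ 1`, `a = 2 ≡ 2 (mod 3)`, `9 ∤ #Ẽ`). `|Δ| = ∏` over `[(5, 10), (43, 2), (293, 1)]`. Kernel: minimality, onto, `3 ∣ #Ш` from `hSel`;
displayed: `hGZK hCT hKo hB`, Heegner datum (`hK hH hP hnt hI`), twist datum (`Wd hWd hrD`), `hr hq hv`, `hSel : 3³ ≤ #Sel^(3)(E/ℚ)`.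
[cite: McCallumLMS1991, §1 Theorem (Kolyvagin), p. 296] [cite: SilvermanAEC2009, Thm. X.4.2(a) and Thm. X.4.14] [cite: Serre1972, §2.4 Prop. 15] [cite: Cremona2006, Table 1 (label 314975c1)] -/
theorem bsdp_q314975c1_3 (hGZK : rank_eq_analyticRank_of_analyticRank_le_one)
    (hCT : exists_casselsTate_pairing (K := ℚ)) (W : WeierstrassCurve ℚ)
    (hW : W = ⟨0, 0, 1, -80000, -8708594⟩) {N : ℕ} [NeZero N] {K : Type} [Field K] [NumberField K]
    (hKo : kolyvagin N W K) (hB : Kolyvagin1990_padicValNat_card_sha_le N W K) (hK : IsImaginaryQuadratic K)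
    (hH : SatisfiesHeegnerHypothesis N K) {P : (W.baseChange K).toAffine.Point} (hP : IsHeegnerPoint N W K P)
    (hnt : ¬ IsOfFinAddOrder P) (hI : padicValNat 3 (AddSubgroup.zmultiples P).index ≤ 1)
    (Wd : WeierstrassCurve ℚ) [Wd.IsElliptic]
    (hWd : ∃ C : VariableChange ℚ, C • W.quadraticTwist ((NumberField.discr K : ℤ) : ℚ) = Wd)
    (hrD : Wd.analyticRank ≤ 1) (hr : W.analyticRank = 1)
    {q : ℚ} (hq : shaAn W = (q : ℂ)) (hv : padicValRat 3 q = 2)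
    (hSel : 3 ^ 3 ≤ Nat.card (W.selmerGroup (3 : ℤ))) : BSDp W 3 :=
  bsdp_three_of_kolyvaginIndexLeOne_of_le_card_selmer_of_irr_of_order 0 0 1 (-80000) (-8708594)
    (Supersingular.isGloballyMinimal_of_krausCriterion₃_factored 0 0 1 (-80000) (-8708594) [(5, 10), (43, 2), (293, 1)] (by decide +kernel)
      (by intro t ht; fin_cases ht <;> norm_num) (by decide +kernel))
    13 7 (by norm_num) (by norm_num) (by decide) (by decide) (by decide) (by decide) (by decide +kernel) (by decide +kernel)
    (n₁ := 8) (n₂ := 6) (by decide +kernel) (by decide +kernel) (by decide) (by decide) (by decide) (by decide)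
    hGZK hCT W hW hKo hB hK hH hP hnt hI Wd hWd hrD hr hq hv hSel

/-- **`BSD(E,3)` for `389104b1`** (`N = 389104 = 2⁴·83·293`; good supersingular at `3`, not semistable (class X7); `#tors = 2`, `∏c = 2`
(`3 ∤ #tors·∏c`), `r_an = 1`, **`#Ш_an = 9`**, galrep 2B (no 3-code: `ρ̄_{E,3}` onto), generator `(15, 42)`; residue class of A2 state `45ab5fdd`,
(3,'X7') the SOLE open cell). HEEGNER INDEX (upper half): fields with `ord₃ m ≥ 2` before the certificate field: none. `D = -55` (55 = 5·11; every
prime of `N` split, `3 ∤ D`): **`m = 6`, `ord₃ m = 1`** (`ρ = ĥ(y_K)/ĥ(x) = 8.99…`; `L′(E,1) = 10.46006551…`, `L(E^D,1) = 0.88780075…`,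
`ĥ(x) = 3.04730371…`) — engine 1 (j303974) = engine 2 (j304100; EQUAL `m = 6`, `ord₃ m = 1`, dev. ≤ 3.0e-15, checks true; `3`-saturation witness
prime [5, 6], `E(K)[3] = 0` witness prime [7, 'split', 4]); twist `E^D` (stage C j304101): minimal model `[0, 0, 0, -211750, 93336375]`,
`N_{E^D} = 1177039600`, root number `+1`, `L(E^D,1) = 0.88780075… ≠ 0` ⇒ `r_an(E^D) = 0`; `#tors = 2`, `∏c = 16`, `#Ш_an(E^D) = 1` —
`3 ∤ #tors·#Ш_an(E^D)` (BSD-shape: the squeeze forces `Ш(E^D)[3] = 0`). DESCENT (lower half): engine C x11b `desc3lib` (j305968): octic `A` disc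
`-3133224991388717545992192`, `S = [2, 3, 83, 293]`, `Cl(A) = [3, [3]]`, `bnfcertify(A,1) = 1`, `12` generators 3-saturated, `dim H¹(ℚ,E[3];S) = 3`,
**`dim Sel^(3)(E/ℚ) = 3`** (expected 3: MATCH), generator in `Sel`, mode `GRH(3sat)`, cert `certs/cert_389104b1.gp` `c0136a88b656dd13…`; engine E
x10b `desc3full_e2` (j305969): `Cl = [3, [3]]`, `Cl_S = [1, []]`, `12` generators, `bnfcertify = -2`, `dim H¹ = 3`, **`dim Sel^(3)(E/ℚ) = 3`**, mode
`LOWERBOUND` — TWO independent implementations, descent grade **LL** (E = equality EXACT, L = three independent EXACTLY verified Selmer elements =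
the unconditional LOWER bound `dim ≥ 3`; the kit uses only `3³ ≤ #Sel`) ⇒ `27 ≤ #Sel^(3)(E/ℚ)`, `Ш(E)[3] ≠ 0` — the lower half. Witnesses mod `3`
`(ℓ,#Ẽ(𝔽_ℓ))` = `(17,20)` (`a = -2`: `X² − aX + ℓ` root-free over `𝔽₃`), `(97,84)` (`ℓ ≡ 1`, `a = 14 ≡ 2 (mod 3)`, `9 ∤ #Ẽ`). `|Δ| = ∏` over
`[(2, 4), (83, 1), (293, 2)]`. Kernel: minimality, onto, `3 ∣ #Ш` from `hSel`; displayed: `hGZK hCT hKo hB`, Heegner datum (`hK hH hP hnt hI`),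
twist datum (`Wd hWd hrD`), `hr hq hv`, `hSel : 3³ ≤ #Sel^(3)(E/ℚ)`.
[cite: McCallumLMS1991, §1 Theorem (Kolyvagin), p. 296] [cite: SilvermanAEC2009, Thm. X.4.2(a) and Thm. X.4.14] [cite: Serre1972, §2.4 Prop. 15] [cite: Cremona2006, Table 1 (label 389104b1)] -/
theorem bsdp_q389104b1_3 (hGZK : rank_eq_analyticRank_of_analyticRank_le_one)
    (hCT : exists_casselsTate_pairing (K := ℚ)) (W : WeierstrassCurve ℚ)
    (hW : W = ⟨0, 0, 0, -70, -561⟩) {N : ℕ} [NeZero N] {K : Type} [Field K] [NumberField K]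
    (hKo : kolyvagin N W K) (hB : Kolyvagin1990_padicValNat_card_sha_le N W K) (hK : IsImaginaryQuadratic K)
    (hH : SatisfiesHeegnerHypothesis N K) {P : (W.baseChange K).toAffine.Point} (hP : IsHeegnerPoint N W K P)
    (hnt : ¬ IsOfFinAddOrder P) (hI : padicValNat 3 (AddSubgroup.zmultiples P).index ≤ 1)
    (Wd : WeierstrassCurve ℚ) [Wd.IsElliptic]
    (hWd : ∃ C : VariableChange ℚ, C • W.quadraticTwist ((NumberField.discr K : ℤ) : ℚ) = Wd)
    (hrD : Wd.analyticRank ≤ 1) (hr : W.analyticRank = 1)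
    {q : ℚ} (hq : shaAn W = (q : ℂ)) (hv : padicValRat 3 q = 2)
    (hSel : 3 ^ 3 ≤ Nat.card (W.selmerGroup (3 : ℤ))) : BSDp W 3 :=
  bsdp_three_of_kolyvaginIndexLeOne_of_le_card_selmer_of_irr_of_order 0 0 0 (-70) (-561)
    (Supersingular.isGloballyMinimal_of_krausCriterion₃_factored 0 0 0 (-70) (-561) [(2, 4), (83, 1), (293, 2)] (by decide +kernel)
      (by intro t ht; fin_cases ht <;> norm_num) (by decide +kernel))
    17 97 (by norm_num) (by norm_num) (by decide) (by decide) (by decide) (by decide) (by decide +kernel) (by decide +kernel)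
    (n₁ := 20) (n₂ := 84) (by decide +kernel) (by decide +kernel) (by decide) (by decide) (by decide) (by decide)
    hGZK hCT W hW hKo hB hK hH hP hnt hI Wd hWd hrD hr hq hv hSel

/-- **`BSD(E,3)` for `389525a1`** (`N = 389525 = 5²·15581`; good supersingular at `3`, not semistable (class X7); `#tors = 2`, `∏c = 2`
(`3 ∤ #tors·∏c`), `r_an = 1`, **`#Ш_an = 9`**, galrep 2B (no 3-code: `ρ̄_{E,3}` onto), generator `(1040, 32324)`; residue class of A2 state
`45ab5fdd`, (3,'X7') the SOLE open cell). HEEGNER INDEX (upper half): fields with `ord₃ m ≥ 2` before the certificate field: `-4`: `m = 6`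
(`ord₃ = 1`). `D = -19` (19 prime; every prime of `N` split, `3 ∤ D`): **`m = 12`, `ord₃ m = 1`** (`ρ = ĥ(y_K)/ĥ(x) = 36.00…`;
`L′(E,1) = 10.67645228…`, `L(E^D,1) = 2.21345558…`, `ĥ(x) = 7.05275204…`) — engine 1 (j303974) = engine 2 (j304152; EQUAL `m = 12`, `ord₃ m = 1`,
dev. ≤ 1.5e-14, checks true; `3`-saturation witness prime [11, 12], `E(K)[3] = 0` witness prime [7, 'split', 4]); twist `E^D` (stage C j304153):
minimal model `[1, -1, 1, -14644755, 21574707122]`, `N_{E^D} = 140618525`, root number `+1`, `L(E^D,1) = 2.21345558… ≠ 0` ⇒ `r_an(E^D) = 0`;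
`#tors = 2`, `∏c = 8`, `#Ш_an(E^D) = 4` — `3 ∤ #tors·#Ш_an(E^D)` (BSD-shape: the squeeze forces `Ш(E^D)[3] = 0`). DESCENT (lower half): engine C
x11b `desc3lib` (j305968): octic `A` disc `-2013956655153041137921875`, `S = [3, 5, 15581]`, `Cl(A) = [6, [6]]`, `bnfcertify(A,1) = 1`, `10`
generators 3-saturated, `dim H¹(ℚ,E[3];S) = 3`, **`dim Sel^(3)(E/ℚ) = 3`** (expected 3: MATCH), generator in `Sel`, mode `GRH(3sat)`, cert
`certs/cert_389525a1.gp` `e2eaadc0992eb919…`; engine E x10b `desc3full_e2` (j305969): `Cl = [6, [6]]`, `Cl_S = [1, []]`, `10` generators,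
`bnfcertify = -2`, `dim H¹ = 3`, **`dim Sel^(3)(E/ℚ) = 3`**, mode `LOWERBOUND` — TWO independent implementations, descent grade **LL** (E = equality
EXACT, L = three independent EXACTLY verified Selmer elements = the unconditional LOWER bound `dim ≥ 3`; the kit uses only `3³ ≤ #Sel`) ⇒
`27 ≤ #Sel^(3)(E/ℚ)`, `Ш(E)[3] ≠ 0` — the lower half. Witnesses mod `3` `(ℓ,#Ẽ(𝔽_ℓ))` = `(23,28)` (`a = -4`: `X² − aX + ℓ` root-free over `𝔽₃`),
`(73,60)` (`ℓ ≡ 1`, `a = 14 ≡ 2 (mod 3)`, `9 ∤ #Ẽ`). `|Δ| = ∏` over `[(5, 7), (15581, 1)]`. Kernel: minimality, onto, `3 ∣ #Ш` from `hSel`;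
displayed: `hGZK hCT hKo hB`, Heegner datum (`hK hH hP hnt hI`), twist datum (`Wd hWd hrD`), `hr hq hv`, `hSel : 3³ ≤ #Sel^(3)(E/ℚ)`.
[cite: McCallumLMS1991, §1 Theorem (Kolyvagin), p. 296] [cite: SilvermanAEC2009, Thm. X.4.2(a) and Thm. X.4.14] [cite: Serre1972, §2.4 Prop. 15] [cite: Cremona2006, Table 1 (label 389525a1)] -/
theorem bsdp_q389525a1_3 (hGZK : rank_eq_analyticRank_of_analyticRank_le_one)
    (hCT : exists_casselsTate_pairing (K := ℚ)) (W : WeierstrassCurve ℚ)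
    (hW : W = ⟨1, -1, 0, -40567, -3134784⟩) {N : ℕ} [NeZero N] {K : Type} [Field K] [NumberField K]
    (hKo : kolyvagin N W K) (hB : Kolyvagin1990_padicValNat_card_sha_le N W K) (hK : IsImaginaryQuadratic K)
    (hH : SatisfiesHeegnerHypothesis N K) {P : (W.baseChange K).toAffine.Point} (hP : IsHeegnerPoint N W K P)
    (hnt : ¬ IsOfFinAddOrder P) (hI : padicValNat 3 (AddSubgroup.zmultiples P).index ≤ 1)
    (Wd : WeierstrassCurve ℚ) [Wd.IsElliptic]
    (hWd : ∃ C : VariableChange ℚ, C • W.quadraticTwist ((NumberField.discr K : ℤ) : ℚ) = Wd)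
    (hrD : Wd.analyticRank ≤ 1) (hr : W.analyticRank = 1)
    {q : ℚ} (hq : shaAn W = (q : ℂ)) (hv : padicValRat 3 q = 2)
    (hSel : 3 ^ 3 ≤ Nat.card (W.selmerGroup (3 : ℤ))) : BSDp W 3 :=
  bsdp_three_of_kolyvaginIndexLeOne_of_le_card_selmer_of_irr_of_order 1 (-1) 0 (-40567) (-3134784)
    (Supersingular.isGloballyMinimal_of_krausCriterion₃_factored 1 (-1) 0 (-40567) (-3134784) [(5, 7), (15581, 1)] (by decide +kernel)
      (by intro t ht; fin_cases ht <;> norm_num) (by decide +kernel))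
    23 73 (by norm_num) (by norm_num) (by decide) (by decide) (by decide) (by decide) (by decide +kernel) (by decide +kernel)
    (n₁ := 28) (n₂ := 60) (by decide +kernel) (by decide +kernel) (by decide) (by decide) (by decide) (by decide)
    hGZK hCT W hW hKo hB hK hH hP hnt hI Wd hWd hrD hr hq hv hSel

/-- **`BSD(E,3)` for `403280p1`** (`N = 403280 = 2⁴·5·71²`; good supersingular at `3`, not semistable (class X7); `#tors = 2`, `∏c = 16`
(`3 ∤ #tors·∏c`), `r_an = 1`, **`#Ш_an = 9`**, galrep 2B (no 3-code: `ρ̄_{E,3}` onto), generator `(5121, 68400)`; residue class of A2 state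
`45ab5fdd`, (3,'X7') the SOLE open cell). HEEGNER INDEX (upper half): fields with `ord₃ m ≥ 2` before the certificate field: none. `D = -31` (31
prime; every prime of `N` split, `3 ∤ D`): **`m = 48`, `ord₃ m = 1`** (`ρ = ĥ(y_K)/ĥ(x) = 576.00…`; `L′(E,1) = 8.32738121…`,
`L(E^D,1) = 0.70170200…`, `ĥ(x) = 6.40453192…`) — engine 1 (j303974) = engine 2 (j304100; EQUAL `m = 48`, `ord₃ m = 1`, dev. ≤ 1.0e-14, checks true;
`3`-saturation witness prime [7, 6], `E(K)[3] = 0` witness prime [11, 'inert', 140]); twist `E^D` (stage C j304101): minimal model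
`[0, 0, 0, -18229480963, 967496338721538]`, `N_{E^D} = 387552080`, root number `+1`, `L(E^D,1) = 0.70170200… ≠ 0` ⇒ `r_an(E^D) = 0`; `#tors = 2`,
`∏c = 32`, `#Ш_an(E^D) = 4` — `3 ∤ #tors·#Ш_an(E^D)` (BSD-shape: the squeeze forces `Ш(E^D)[3] = 0`). DESCENT (lower half): engine C x11b `desc3lib`
(j305968): octic `A` disc `-179299405398545280000`, `S = [2, 3, 5, 71]`, `Cl(A) = [216, [108, 2]]`, `bnfcertify(A,1) = 1`, `12` generators
3-saturated, `dim H¹(ℚ,E[3];S) = 3`, **`dim Sel^(3)(E/ℚ) = 3`** (expected 3: MATCH), generator in `Sel`, mode `GRH(3sat)`, cert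
`certs/cert_403280p1.gp` `17c198e494c7b385…`; engine E x10b `desc3full_e2` (j305969): `Cl = [216, [108, 2]]`, `Cl_S = [1, []]`, `12` generators,
`bnfcertify = -2`, `dim H¹ = 3`, **`dim Sel^(3)(E/ℚ) = 3`**, mode `LOWERBOUND` — TWO independent implementations, descent grade **LL** (E = equality
EXACT, L = three independent EXACTLY verified Selmer elements = the unconditional LOWER bound `dim ≥ 3`; the kit uses only `3³ ≤ #Sel`) ⇒
`27 ≤ #Sel^(3)(E/ℚ)`, `Ш(E)[3] ≠ 0` — the lower half. Witnesses mod `3` `(ℓ,#Ẽ(𝔽_ℓ))` = `(11,10)` (`a = 2`: `X² − aX + ℓ` root-free over `𝔽₃`),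
`(7,6)` (`ℓ ≡ 1`, `a = 2 ≡ 2 (mod 3)`, `9 ∤ #Ẽ`). `|Δ| = ∏` over `[(2, 14), (5, 2), (71, 9)]`. Kernel: minimality, onto, `3 ∣ #Ш` from `hSel`;
displayed: `hGZK hCT hKo hB`, Heegner datum (`hK hH hP hnt hI`), twist datum (`Wd hWd hrD`), `hr hq hv`, `hSel : 3³ ≤ #Sel^(3)(E/ℚ)`.
[cite: McCallumLMS1991, §1 Theorem (Kolyvagin), p. 296] [cite: SilvermanAEC2009, Thm. X.4.2(a) and Thm. X.4.14] [cite: Serre1972, §2.4 Prop. 15] [cite: Cremona2006, Table 1 (label 403280p1)] -/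
theorem bsdp_q403280p1_3 (hGZK : rank_eq_analyticRank_of_analyticRank_le_one)
    (hCT : exists_casselsTate_pairing (K := ℚ)) (W : WeierstrassCurve ℚ)
    (hW : W = ⟨0, 0, 0, -18969283, -32476128318⟩) {N : ℕ} [NeZero N] {K : Type} [Field K] [NumberField K]
    (hKo : kolyvagin N W K) (hB : Kolyvagin1990_padicValNat_card_sha_le N W K) (hK : IsImaginaryQuadratic K)
    (hH : SatisfiesHeegnerHypothesis N K) {P : (W.baseChange K).toAffine.Point} (hP : IsHeegnerPoint N W K P)
    (hnt : ¬ IsOfFinAddOrder P) (hI : padicValNat 3 (AddSubgroup.zmultiples P).index ≤ 1)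
    (Wd : WeierstrassCurve ℚ) [Wd.IsElliptic]
    (hWd : ∃ C : VariableChange ℚ, C • W.quadraticTwist ((NumberField.discr K : ℤ) : ℚ) = Wd)
    (hrD : Wd.analyticRank ≤ 1) (hr : W.analyticRank = 1)
    {q : ℚ} (hq : shaAn W = (q : ℂ)) (hv : padicValRat 3 q = 2)
    (hSel : 3 ^ 3 ≤ Nat.card (W.selmerGroup (3 : ℤ))) : BSDp W 3 :=
  bsdp_three_of_kolyvaginIndexLeOne_of_le_card_selmer_of_irr_of_order 0 0 0 (-18969283) (-32476128318)
    (Supersingular.isGloballyMinimal_of_krausCriterion₃_factored 0 0 0 (-18969283) (-32476128318) [(2, 14), (5, 2), (71, 9)] (by decide +kernel)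
      (by intro t ht; fin_cases ht <;> norm_num) (by decide +kernel))
    11 7 (by norm_num) (by norm_num) (by decide) (by decide) (by decide) (by decide) (by decide +kernel) (by decide +kernel)
    (n₁ := 10) (n₂ := 6) (by decide +kernel) (by decide +kernel) (by decide) (by decide) (by decide) (by decide)
    hGZK hCT W hW hKo hB hK hH hP hnt hI Wd hWd hrD hr hq hv hSel

/-- **`BSD(E,3)` for `404968b1`** (`N = 404968 = 2³·223·227`; good supersingular at `3`, not semistable (class X7); `#tors = 2`, `∏c = 2`
(`3 ∤ #tors·∏c`), `r_an = 1`, **`#Ш_an = 9`**, galrep 2B (no 3-code: `ρ̄_{E,3}` onto), generator `(150, 15)`; residue class of A2 state `45ab5fdd`,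
(3,'X7') the SOLE open cell; register ["('MANIN-DB', 'tail')", "('MANIN-DB', 223)", "('MANIN-DB', 227)"]). HEEGNER INDEX (upper half): fields with
`ord₃ m ≥ 2` before the certificate field: none. `D = -95` (95 = 5·19; every prime of `N` split, `3 ∤ D`): **`m = 12`, `ord₃ m = 1`**
(`ρ = ĥ(y_K)/ĥ(x) = 35.99…`; `L′(E,1) = 9.55595587…`, `L(E^D,1) = 1.48889340…`, `ĥ(x) = 5.06951693…`) — engine 1 (j303974) = engine 2 (j304100;
EQUAL `m = 12`, `ord₃ m = 1`, dev. ≤ 2.3e-14, checks true; `3`-saturation witness prime [11, 12], `E(K)[3] = 0` witness prime [7, 'inert', 64]);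
twist `E^D` (stage C j304101): minimal model `[0, 0, 0, -152287850, 723345853125]`, `N_{E^D} = 3654836200`, root number `+1`,
`L(E^D,1) = 1.48889340… ≠ 0` ⇒ `r_an(E^D) = 0`; `#tors = 2`, `∏c = 32`, `#Ш_an(E^D) = 1` — `3 ∤ #tors·#Ш_an(E^D)` (BSD-shape: the squeeze forces
`Ш(E^D)[3] = 0`). DESCENT (lower half): engine C x11b `desc3lib` (j305968): octic `A` disc `-14705223196819755608828928`, `S = [2, 3, 223, 227]`,
`Cl(A) = [24, [6, 2, 2]]`, `bnfcertify(A,1) = 1`, `13` generators 3-saturated, `dim H¹(ℚ,E[3];S) = 4`, **`dim Sel^(3)(E/ℚ) = 3`** (expected 3: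
MATCH), generator in `Sel`, mode `GRH(3sat)`, cert `certs/cert_404968b1.gp` `f6c82b8dd69357c2…`; engine E x10b `desc3full_e2` (j305969):
`Cl = [24, [6, 2, 2]]`, `Cl_S = [2, [2]]`, `13` generators, `bnfcertify = -2`, `dim H¹ = 4`, **`dim Sel^(3)(E/ℚ) = 3`**, mode `LOWERBOUND` — TWO
independent implementations, descent grade **LL** (E = equality EXACT, L = three independent EXACTLY verified Selmer elements = the unconditional
LOWER bound `dim ≥ 3`; the kit uses only `3³ ≤ #Sel`) ⇒ `27 ≤ #Sel^(3)(E/ℚ)`, `Ш(E)[3] ≠ 0` — the lower half. Witnesses mod `3` `(ℓ,#Ẽ(𝔽_ℓ))` =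
`(5,4)` (`a = 2`: `X² − aX + ℓ` root-free over `𝔽₃`), `(13,12)` (`ℓ ≡ 1`, `a = 2 ≡ 2 (mod 3)`, `9 ∤ #Ẽ`). `|Δ| = ∏` over
`[(2, 4), (223, 1), (227, 1)]`. Kernel: minimality, onto, `3 ∣ #Ш` from `hSel`; displayed: `hGZK hCT hKo hB`, Heegner datum (`hK hH hP hnt hI`),
twist datum (`Wd hWd hrD`), `hr hq hv`, `hSel : 3³ ≤ #Sel^(3)(E/ℚ)`.
[cite: McCallumLMS1991, §1 Theorem (Kolyvagin), p. 296] [cite: SilvermanAEC2009, Thm. X.4.2(a) and Thm. X.4.14] [cite: Serre1972, §2.4 Prop. 15] [cite: Cremona2006, Table 1 (label 404968b1)] -/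
theorem bsdp_q404968b1_3 (hGZK : rank_eq_analyticRank_of_analyticRank_le_one)
    (hCT : exists_casselsTate_pairing (K := ℚ)) (W : WeierstrassCurve ℚ)
    (hW : W = ⟨0, 0, 0, -16874, -843675⟩) {N : ℕ} [NeZero N] {K : Type} [Field K] [NumberField K]
    (hKo : kolyvagin N W K) (hB : Kolyvagin1990_padicValNat_card_sha_le N W K) (hK : IsImaginaryQuadratic K)
    (hH : SatisfiesHeegnerHypothesis N K) {P : (W.baseChange K).toAffine.Point} (hP : IsHeegnerPoint N W K P)
    (hnt : ¬ IsOfFinAddOrder P) (hI : padicValNat 3 (AddSubgroup.zmultiples P).index ≤ 1)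
    (Wd : WeierstrassCurve ℚ) [Wd.IsElliptic]
    (hWd : ∃ C : VariableChange ℚ, C • W.quadraticTwist ((NumberField.discr K : ℤ) : ℚ) = Wd)
    (hrD : Wd.analyticRank ≤ 1) (hr : W.analyticRank = 1)
    {q : ℚ} (hq : shaAn W = (q : ℂ)) (hv : padicValRat 3 q = 2)
    (hSel : 3 ^ 3 ≤ Nat.card (W.selmerGroup (3 : ℤ))) : BSDp W 3 :=
  bsdp_three_of_kolyvaginIndexLeOne_of_le_card_selmer_of_irr_of_order 0 0 0 (-16874) (-843675)
    (Supersingular.isGloballyMinimal_of_krausCriterion₃_factored 0 0 0 (-16874) (-843675) [(2, 4), (223, 1), (227, 1)] (by decide +kernel)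
      (by intro t ht; fin_cases ht <;> norm_num) (by decide +kernel))
    5 13 (by norm_num) (by norm_num) (by decide) (by decide) (by decide) (by decide) (by decide +kernel) (by decide +kernel)
    (n₁ := 4) (n₂ := 12) (by decide +kernel) (by decide +kernel) (by decide) (by decide) (by decide) (by decide)
    hGZK hCT W hW hKo hB hK hH hP hnt hI Wd hWd hrD hr hq hv hSel

/-- **`BSD(E,3)` for `453200bn1`** (`N = 453200 = 2⁴·5²·11·103`; good supersingular at `3`, not semistable (class X7); `#tors = 2`, `∏c = 8`
(`3 ∤ #tors·∏c`), `r_an = 1`, **`#Ш_an = 9`**, galrep 2B (no 3-code: `ρ̄_{E,3}` onto), generator `(-379, 206)`; residue class of A2 state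
`45ab5fdd`, (3,'X7') the SOLE open cell). HEEGNER INDEX (upper half): fields with `ord₃ m ≥ 2` before the certificate field: none. `D = -151` (151
prime; every prime of `N` split, `3 ∤ D`): **`m = 24`, `ord₃ m = 1`** (`ρ = ĥ(y_K)/ĥ(x) = 144.00…`; `L′(E,1) = 8.34423468…`,
`L(E^D,1) = 0.27817237…`, `ĥ(x) = 2.49643981…`) — engine 1 (j303974) = engine 2 (j304100; EQUAL `m = 24`, `ord₃ m = 1`, dev. ≤ 3.4e-14, checks true;
`3`-saturation witness prime [23, 24], `E(K)[3] = 0` witness prime [17, 'split', 22]); twist `E^D` (stage C j304101): minimal model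
`[0, 0, 0, -9964037000, 382651725984375]`, `N_{E^D} = 10333413200`, root number `+1`, `L(E^D,1) = 0.27817237… ≠ 0` ⇒ `r_an(E^D) = 0`; `#tors = 2`,
`∏c = 32`, `#Ш_an(E^D) = 1` — `3 ∤ #tors·#Ш_an(E^D)` (BSD-shape: the squeeze forces `Ш(E^D)[3] = 0`). DESCENT (lower half): engine C x11b `desc3lib`
(j305968): octic `A` disc `-57661827845645232000000`, `S = [2, 3, 5, 7, 11, 13, 17, 19, 23, 103]`, `Cl(A) = [96, [12, 4, 2]]`,
`bnfcertify(A,1) = 1`, `25` generators 3-saturated, `dim H¹(ℚ,E[3];S) = 3`, **`dim Sel^(3)(E/ℚ) = 3`** (expected 3: MATCH), generator in `Sel`, mode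
`GRH(3sat)`, cert `certs/cert_453200bn1.gp` `ddb09341b7b44de9…`; engine E x10b `desc3full_e2` (j305969): `Cl = [96, [12, 4, 2]]`, `Cl_S = [1, []]`,
`25` generators, `bnfcertify = -2`, `dim H¹ = 3`, **`dim Sel^(3)(E/ℚ) = 3`**, mode `LOWERBOUND` — TWO independent implementations, descent grade
**LL** (E = equality EXACT, L = three independent EXACTLY verified Selmer elements = the unconditional LOWER bound `dim ≥ 3`; the kit uses only
`3³ ≤ #Sel`) ⇒ `27 ≤ #Sel^(3)(E/ℚ)`, `Ш(E)[3] ≠ 0` — the lower half. Witnesses mod `3` `(ℓ,#Ẽ(𝔽_ℓ))` = `(17,22)` (`a = -4`: `X² − aX + ℓ` root-free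
over `𝔽₃`), `(37,42)` (`ℓ ≡ 1`, `a = -4 ≡ 2 (mod 3)`, `9 ∤ #Ẽ`). `|Δ| = ∏` over `[(2, 4), (5, 9), (11, 4), (103, 2)]`. Kernel: minimality, onto,
`3 ∣ #Ш` from `hSel`; displayed: `hGZK hCT hKo hB`, Heegner datum (`hK hH hP hnt hI`), twist datum (`Wd hWd hrD`), `hr hq hv`,
`hSel : 3³ ≤ #Sel^(3)(E/ℚ)`.
[cite: McCallumLMS1991, §1 Theorem (Kolyvagin), p. 296] [cite: SilvermanAEC2009, Thm. X.4.2(a) and Thm. X.4.14] [cite: Serre1972, §2.4 Prop. 15] [cite: Cremona2006, Table 1 (label 453200bn1)] -/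
theorem bsdp_q453200bn1_3 (hGZK : rank_eq_analyticRank_of_analyticRank_le_one)
    (hCT : exists_casselsTate_pairing (K := ℚ)) (W : WeierstrassCurve ℚ)
    (hW : W = ⟨0, 0, 0, -437000, -111140625⟩) {N : ℕ} [NeZero N] {K : Type} [Field K] [NumberField K]
    (hKo : kolyvagin N W K) (hB : Kolyvagin1990_padicValNat_card_sha_le N W K) (hK : IsImaginaryQuadratic K)
    (hH : SatisfiesHeegnerHypothesis N K) {P : (W.baseChange K).toAffine.Point} (hP : IsHeegnerPoint N W K P)
    (hnt : ¬ IsOfFinAddOrder P) (hI : padicValNat 3 (AddSubgroup.zmultiples P).index ≤ 1)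
    (Wd : WeierstrassCurve ℚ) [Wd.IsElliptic]
    (hWd : ∃ C : VariableChange ℚ, C • W.quadraticTwist ((NumberField.discr K : ℤ) : ℚ) = Wd)
    (hrD : Wd.analyticRank ≤ 1) (hr : W.analyticRank = 1)
    {q : ℚ} (hq : shaAn W = (q : ℂ)) (hv : padicValRat 3 q = 2)
    (hSel : 3 ^ 3 ≤ Nat.card (W.selmerGroup (3 : ℤ))) : BSDp W 3 :=
  bsdp_three_of_kolyvaginIndexLeOne_of_le_card_selmer_of_irr_of_order 0 0 0 (-437000) (-111140625)
    (Supersingular.isGloballyMinimal_of_krausCriterion₃_factored 0 0 0 (-437000) (-111140625) [(2, 4), (5, 9), (11, 4), (103, 2)] (by decide +kernel)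
      (by intro t ht; fin_cases ht <;> norm_num) (by decide +kernel))
    17 37 (by norm_num) (by norm_num) (by decide) (by decide) (by decide) (by decide) (by decide +kernel) (by decide +kernel)
    (n₁ := 22) (n₂ := 42) (by decide +kernel) (by decide +kernel) (by decide) (by decide) (by decide) (by decide)
    hGZK hCT W hW hKo hB hK hH hP hnt hI Wd hWd hrD hr hq hv hSel

/-- **`BSD(E,3)` for `480704bq1`** (`N = 480704 = 2⁶·7·29·37`; good supersingular at `3`, not semistable (class X7); `#tors = 2`, `∏c = 16`
(`3 ∤ #tors·∏c`), `r_an = 1`, **`#Ш_an = 9`**, galrep 2B (no 3-code: `ρ̄_{E,3}` onto), generator `(294, 7424)`; residue class of A2 state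
`45ab5fdd`, (3,'X7') the SOLE open cell). HEEGNER INDEX (upper half): fields with `ord₃ m ≥ 2` before the certificate field: none. `D = -719` (719
prime; every prime of `N` split, `3 ∤ D`): **`m = 96`, `ord₃ m = 1`** (`ρ = ĥ(y_K)/ĥ(x) = 2303.99…`; `L′(E,1) = 10.49069075…`,
`L(E^D,1) = 0.82041767…`, `ĥ(x) = 2.07571165…`) — engine 1 (j303974) = engine 2 (j304100; EQUAL `m = 96`, `ord₃ m = 1`, dev. ≤ 3.9e-14, checks true;
`3`-saturation witness prime [13, 12], `E(K)[3] = 0` witness prime [5, 'split', 4]); twist `E^D` (stage C j304101): minimal model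
`[0, 0, 0, 138440087956, 18223621022074288]`, `N_{E^D} = 248505220544`, root number `+1`, `L(E^D,1) = 0.82041767… ≠ 0` ⇒ `r_an(E^D) = 0`;
`#tors = 2`, `∏c = 32`, `#Ш_an(E^D) = 16` — `3 ∤ #tors·#Ш_an(E^D)` (BSD-shape: the squeeze forces `Ш(E^D)[3] = 0`). DESCENT (lower half): engine C
x11b `desc3lib` (j305968): octic `A` disc `-47497156455121993728`, `S = [2, 3, 5, 7, 11, 13, 29, 37]`, `Cl(A) = [6, [6]]`, `bnfcertify(A,1) = 1`,
`20` generators 3-saturated, `dim H¹(ℚ,E[3];S) = 3`, **`dim Sel^(3)(E/ℚ) = 3`** (expected 3: MATCH), generator in `Sel`, mode `GRH(3sat)`, cert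
`certs/cert_480704bq1.gp` `b044ea40450c237d…`; engine E x10b `desc3full_e2` (j305969): `Cl = [6, [6]]`, `Cl_S = [1, []]`, `20` generators,
`bnfcertify = -2`, `dim H¹ = 3`, **`dim Sel^(3)(E/ℚ) = 3`**, mode `LOWERBOUND` — TWO independent implementations, descent grade **LL** (E = equality
EXACT, L = three independent EXACTLY verified Selmer elements = the unconditional LOWER bound `dim ≥ 3`; the kit uses only `3³ ≤ #Sel`) ⇒
`27 ≤ #Sel^(3)(E/ℚ)`, `Ш(E)[3] ≠ 0` — the lower half. Witnesses mod `3` `(ℓ,#Ẽ(𝔽_ℓ))` = `(5,4)` (`a = 2`: `X² − aX + ℓ` root-free over `𝔽₃`),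
`(13,12)` (`ℓ ≡ 1`, `a = 2 ≡ 2 (mod 3)`, `9 ∤ #Ẽ`). `|Δ| = ∏` over `[(2, 22), (7, 3), (29, 2), (37, 4)]`. Kernel: minimality, onto, `3 ∣ #Ш` from
`hSel`; displayed: `hGZK hCT hKo hB`, Heegner datum (`hK hH hP hnt hI`), twist datum (`Wd hWd hrD`), `hr hq hv`, `hSel : 3³ ≤ #Sel^(3)(E/ℚ)`.
[cite: McCallumLMS1991, §1 Theorem (Kolyvagin), p. 296] [cite: SilvermanAEC2009, Thm. X.4.2(a) and Thm. X.4.14] [cite: Serre1972, §2.4 Prop. 15] [cite: Cremona2006, Table 1 (label 480704bq1)] -/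
theorem bsdp_q480704bq1_3 (hGZK : rank_eq_analyticRank_of_analyticRank_le_one)
    (hCT : exists_casselsTate_pairing (K := ℚ)) (W : WeierstrassCurve ℚ)
    (hW : W = ⟨0, 0, 0, 267796, -49028432⟩) {N : ℕ} [NeZero N] {K : Type} [Field K] [NumberField K]
    (hKo : kolyvagin N W K) (hB : Kolyvagin1990_padicValNat_card_sha_le N W K) (hK : IsImaginaryQuadratic K)
    (hH : SatisfiesHeegnerHypothesis N K) {P : (W.baseChange K).toAffine.Point} (hP : IsHeegnerPoint N W K P)
    (hnt : ¬ IsOfFinAddOrder P) (hI : padicValNat 3 (AddSubgroup.zmultiples P).index ≤ 1)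
    (Wd : WeierstrassCurve ℚ) [Wd.IsElliptic]
    (hWd : ∃ C : VariableChange ℚ, C • W.quadraticTwist ((NumberField.discr K : ℤ) : ℚ) = Wd)
    (hrD : Wd.analyticRank ≤ 1) (hr : W.analyticRank = 1)
    {q : ℚ} (hq : shaAn W = (q : ℂ)) (hv : padicValRat 3 q = 2)
    (hSel : 3 ^ 3 ≤ Nat.card (W.selmerGroup (3 : ℤ))) : BSDp W 3 :=
  bsdp_three_of_kolyvaginIndexLeOne_of_le_card_selmer_of_irr_of_order 0 0 0 267796 (-49028432)
    (Supersingular.isGloballyMinimal_of_krausCriterion₃_factored 0 0 0 267796 (-49028432) [(2, 22), (7, 3), (29, 2), (37, 4)] (by decide +kernel)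
      (by intro t ht; fin_cases ht <;> norm_num) (by decide +kernel))
    5 13 (by norm_num) (by norm_num) (by decide) (by decide) (by decide) (by decide) (by decide +kernel) (by decide +kernel)
    (n₁ := 4) (n₂ := 12) (by decide +kernel) (by decide +kernel) (by decide) (by decide) (by decide) (by decide)
    hGZK hCT W hW hKo hB hK hH hP hnt hI Wd hWd hrD hr hq hv hSel

end Summit.BirchSwinnertonDyer.Rank1Residual.X11b

end
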